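import Mathlib
import Literature.MathematicalPhysics.QuantumFieldTheory.Luscher2010.FlowActionSeries
import Literature.MathematicalPhysics.QuantumFieldTheory.LatticeGaugeDobrushinPoincare
import Literature.MathematicalPhysics.QuantumFieldTheory.UnitaryTraceConcentration
import HarnessLib

/-!
# Lüscher 2010 — proofs, part 2: invertibility of the one-link Euler step (§5.2, App. D)

M. Lüscher, *Trivializing maps, the Wilson flow and the HMC algorithm*, Commun. Math. Phys. 293 (2010)
899–919, arXiv:0907.5491 [Luscher2010Trivializing]. This file PROVES the cited statement
`EulerStepInvertible` of `Luscher2010/FlowActionSeries.lean` (file B): for `|ε| < 1/8`, `d = 4`, gauge group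
`SU(3)` and `L ≥ 2` the one-link Euler step (5.1) `U(x,μ) ↦ e^{ε Z(U)(x,μ)} U(x,μ)` of the Wilson flow
restricts to a bijection of `SU(3)^E`. The argument is App. D of the paper run in the FROBENIUS norm
instead of the operator norm, which makes it uniform in the gauge group: (i) the projection `𝒫` (A.2) onto
`𝔰𝔲(n)` does not increase the Frobenius norm (it is the orthogonal projection for `Re tr(AᴴB)`; the factor
`4/3` of (D.1) is specific to the operator norm); (ii) `‖e^X − e^Y‖_F ≤ ‖X − Y‖_F` for skew-Hermitian
`X, Y` ((B.3)/(B.9) in Frobenius dress: `e^X − e^Y = ∫₀¹ e^{sX}(X − Y)e^{(1−s)Y} ds` with unitary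
outer factors); (iii) for `L ≥ 2` the updated link does not occur in its own staples, so the loop sum
`Ω_{x,μ}` is `U(x,μ)` times a sum of `2(d−1)` products of three unitaries (App. C (C.3)); hence the map `f`
of (D.6) is `2(d−1)|ε|`-Lipschitz on `(𝔰𝔲(n), ‖·‖_F)` and a strict contraction for `2(d−1)|ε| < 1` (at
`d = 4`: `|ε| < 1/6 ⊋` the printed `|ε| < 1/8` of (5.5)), whose unique fixed point (Banach, as in D.2) yields
the unique pre-image. Main results: `eulerStep_bijective` (every `d`, `n`, `L ≥ 2`, `2(d−1)|ε| < 1`) and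
`eulerStepInvertible_holds : EulerStepInvertible L`.

HONEST FRAMING (venture LatticeQCDFlow, cell lqcd-flow): exact (Metropolis-corrected) sampling algorithms
for lattice gauge theory; figures of merit are autocorrelation/cost numbers at stated couplings and
volumes; no continuum-physics claim. Authored by the pub-lqcd theory-1 seats; file of record
`HOME/lean/theory1/LuscherD_EulerStepProofs.lean`.
-/

open scoped Matrix

namespace Literature.MathematicalPhysics.QuantumFieldTheory.Luscher2010

open Literature.MathematicalPhysics.QuantumFieldTheory
open Literature.MathematicalPhysics.QuantumFieldTheory.WilsonFlow

noncomputable section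

/-! ## Frobenius-norm tools: the projection `𝒫`, the exponential map on `𝔰𝔲(n)` -/

section FrobeniusTools

variable {n : ℕ}

open scoped Matrix.Norms.Frobenius

/-- `𝒫` is additive/ℝ-linear: `𝒫(A − B) = 𝒫A − 𝒫B`. [cite: Luscher2010Trivializing, App. A eq. (A.2)] -/
theorem suProj_sub (A B : Matrix (Fin n) (Fin n) ℂ) : suProj (A - B) = suProj A - suProj B := by
  simp only [suProj_def, Matrix.conjTranspose_sub, Matrix.trace_sub, mul_sub, sub_smul, smul_sub]
  abel

/-- **Pythagoras for the Hilbert–Schmidt pairing**: if `Re tr(AᴴB) = 0` then `‖A + B‖_F² = ‖A‖_F² + ‖B‖_F²`.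
[cite: Luscher2010Trivializing, App. A eqs. (A.2)–(A.4)] -/
theorem frobNorm_sq_add_of_orthogonal {A B : Matrix (Fin n) (Fin n) ℂ} (h : (Aᴴ * B).trace.re = 0) :
    frobNorm (A + B) ^ 2 = frobNorm A ^ 2 + frobNorm B ^ 2 := by
  have h' : (Bᴴ * A).trace.re = 0 := by
    have : Bᴴ * A = (Aᴴ * B)ᴴ := by rw [Matrix.conjTranspose_mul, Matrix.conjTranspose_conjTranspose]
    rw [this, Matrix.trace_conjTranspose, Complex.star_def, Complex.conj_re, h]
  rw [frobNorm_sq_eq_re_trace, frobNorm_sq_eq_re_trace, frobNorm_sq_eq_re_trace, Matrix.conjTranspose_add,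
    add_mul, mul_add, mul_add, Matrix.trace_add, Matrix.trace_add, Matrix.trace_add, Complex.add_re,
    Complex.add_re, Complex.add_re, h, h']
  ring

/-- A summand of an orthogonal sum is no longer than the sum: `Re tr(AᴴB) = 0 → ‖A‖_F ≤ ‖A + B‖_F`.
[cite: Luscher2010Trivializing, App. A eqs. (A.2)–(A.4)] -/
theorem frobNorm_le_of_orthogonal {A B : Matrix (Fin n) (Fin n) ℂ} (h : (Aᴴ * B).trace.re = 0) :
    frobNorm A ≤ frobNorm (A + B) := by
  have h2 := frobNorm_sq_add_of_orthogonal h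
  have hA := frobNorm_nonneg A
  have hAB := frobNorm_nonneg (A + B)
  nlinarith [sq_nonneg (frobNorm B), sq_nonneg (frobNorm A - frobNorm (A + B))]

/-- **`𝒫` does not increase the Frobenius norm**: `‖𝒫M‖_F ≤ ‖M‖_F` — `𝒫` is the orthogonal projection onto
`𝔰𝔲(n)` for `Re tr(AᴴB)`, so `‖𝒫M‖_F ≤ ‖½(M − Mᴴ)‖_F ≤ ‖M‖_F` (contrast (D.1): the factor `4/3` there is the
price of the OPERATOR norm on `3 × 3` matrices). [cite: Luscher2010Trivializing, App. A eqs. (A.2)–(A.4), App. D eq. (D.1)] -/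
theorem frobNorm_suProj_le (M : Matrix (Fin n) (Fin n) ℂ) : frobNorm (suProj M) ≤ frobNorm M := by
  set c : ℂ := (1 / (2 * n) : ℂ) * (M - Mᴴ).trace with hc
  have hdecomp : suProj M + c • (1 : Matrix (Fin n) (Fin n) ℂ) = (1 / 2 : ℂ) • (M - Mᴴ) := by
    rw [suProj_def, hc, sub_add_cancel]
  have horth : ((suProj M)ᴴ * (c • (1 : Matrix (Fin n) (Fin n) ℂ))).trace.re = 0 := by
    rw [conjTranspose_suProj, Matrix.mul_smul, Matrix.mul_one, Matrix.trace_smul, Matrix.trace_neg, trace_suProj,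
      neg_zero, smul_zero, Complex.zero_re]
  have hhalf : ‖(1 / 2 : ℂ)‖ = 1 / 2 := by
    rw [show (1 / 2 : ℂ) = ((1 / 2 : ℝ) : ℂ) by push_cast; ring, Complex.norm_real, Real.norm_eq_abs,
      abs_of_nonneg (by norm_num)]
  calc frobNorm (suProj M) ≤ frobNorm (suProj M + c • 1) := frobNorm_le_of_orthogonal horth
    _ = frobNorm ((1 / 2 : ℂ) • (M - Mᴴ)) := by rw [hdecomp]
    _ = 1 / 2 * frobNorm (M - Mᴴ) := by rw [frobNorm_smul, hhalf]
    _ ≤ 1 / 2 * (frobNorm M + frobNorm Mᴴ) := by gcongr; exact frobNorm_sub_le_add _ _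
    _ = frobNorm M := by rw [frobNorm_conjTranspose]; ring

/-- The exponential of a traceless skew-Hermitian matrix is special unitary (`exp 𝔰𝔲(n) ⊆ SU(n)`; via the
tree's `mem_SU_of_ode` along `s ↦ e^{sX}`). [cite: Luscher2010Trivializing, §3.1 eq. (3.2), App. A] -/
theorem exp_mem_specialUnitaryGroup {X : Matrix (Fin n) (Fin n) ℂ} (hX : Xᴴ = -X) (hX0 : X.trace = 0) :
    NormedSpace.exp X ∈ Matrix.specialUnitaryGroup (Fin n) ℂ := by
  have hA : ∀ τ ∈ Set.Icc (0 : ℝ) 1, HasDerivWithinAt (fun s : ℝ => NormedSpace.exp (s • X))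
      (-(fun _ : ℝ => -X) τ * NormedSpace.exp (τ • X)) (Set.Icc (0 : ℝ) 1) τ := by
    intro τ _
    rw [neg_neg]
    exact (hasDerivAt_exp_smul_const' (𝕂 := ℝ) X τ).hasDerivWithinAt
  have h := mem_SU_of_ode (A := fun s : ℝ => NormedSpace.exp (s • X)) (X := fun _ : ℝ => -X) (a := 0) (b := 1)
    (t₀ := 0) ⟨le_rfl, zero_le_one⟩ hA (fun _ _ => by rw [Matrix.conjTranspose_neg, hX, neg_neg])
    (fun _ _ => by rw [Matrix.trace_neg, hX0, neg_zero])
    (by rw [zero_smul, NormedSpace.exp_zero]; exact one_mem _) 1 ⟨zero_le_one, le_rfl⟩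
  simpa using h

/-- **Lipschitz bound for the exponential map on `𝔰𝔲(n)` in the Frobenius norm**: for skew-Hermitian
`X, Y`, `‖e^X − e^Y‖_F ≤ ‖X − Y‖_F` — from `e^X − e^Y = ∫₀¹ e^{sX}(X − Y)e^{(1−s)Y} ds` and the unitarity
of `e^{sX}`, `e^{(1−s)Y}` ((B.3)/(B.9) in Frobenius dress; mean-value inequality along the path
`s ↦ e^{sX}e^{(1−s)Y}`). [cite: Luscher2010Trivializing, App. B eqs. (B.3), (B.9), App. D eq. (D.5)] -/
theorem frobNorm_exp_sub_exp_le {X Y : Matrix (Fin n) (Fin n) ℂ} (hX : Xᴴ = -X) (hY : Yᴴ = -Y) :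
    frobNorm (NormedSpace.exp X - NormedSpace.exp Y) ≤ frobNorm (X - Y) := by
  set γ : ℝ → Matrix (Fin n) (Fin n) ℂ :=
    fun s => NormedSpace.exp (s • X) * NormedSpace.exp ((1 - s) • Y) with hγ
  have hderiv : ∀ s : ℝ, HasDerivAt γ
      (NormedSpace.exp (s • X) * X * NormedSpace.exp ((1 - s) • Y) +
        NormedSpace.exp (s • X) * -(Y * NormedSpace.exp ((1 - s) • Y))) s := fun s =>
    (hasDerivAt_exp_smul_const (𝕂 := ℝ) X s).fun_mul
      (((hasDerivAt_exp_smul_const' (𝕂 := ℝ) Y (1 - s)).scomp s ((hasDerivAt_id s).const_sub 1)).congr_deriv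
        (neg_one_smul ℝ _))
  have hbound : ∀ s ∈ Set.Ico (0 : ℝ) 1, ‖NormedSpace.exp (s • X) * X * NormedSpace.exp ((1 - s) • Y) +
      NormedSpace.exp (s • X) * -(Y * NormedSpace.exp ((1 - s) • Y))‖ ≤ frobNorm (X - Y) := by
    intro s _
    rw [show NormedSpace.exp (s • X) * X * NormedSpace.exp ((1 - s) • Y) +
          NormedSpace.exp (s • X) * -(Y * NormedSpace.exp ((1 - s) • Y)) =
        NormedSpace.exp (s • X) * (X - Y) * NormedSpace.exp ((1 - s) • Y) by noncomm_ring,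
      ← frobNorm_eq_norm, frobNorm_mul_unitary _ (exp_smul_mem_unitaryGroup hY _),
      frobNorm_unitary_mul (exp_smul_mem_unitaryGroup hX _)]
  have key := norm_image_sub_le_of_norm_deriv_le_segment_01' (fun s _ => (hderiv s).hasDerivWithinAt) hbound
  have h1 : γ 1 = NormedSpace.exp X := by simp [hγ]
  have h0 : γ 0 = NormedSpace.exp Y := by simp [hγ]
  rw [h1, h0, ← frobNorm_eq_norm] at key
  exact key

/-- `e^{X} e^{-X} = 1`. [cite: Luscher2010Trivializing, App. B eq. (B.8)] -/
theorem exp_mul_exp_neg (X : Matrix (Fin n) (Fin n) ℂ) : NormedSpace.exp X * NormedSpace.exp (-X) = 1 := by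
  rw [← Matrix.exp_add_of_commute _ _ (Commute.refl X).neg_right, add_neg_cancel, NormedSpace.exp_zero]

/-- `e^{-X} e^{X} = 1`. [cite: Luscher2010Trivializing, App. B eq. (B.8)] -/
theorem exp_neg_mul_exp (X : Matrix (Fin n) (Fin n) ℂ) : NormedSpace.exp (-X) * NormedSpace.exp X = 1 := by
  rw [← Matrix.exp_add_of_commute _ _ (Commute.refl X).neg_left, neg_add_cancel, NormedSpace.exp_zero]

end FrobeniusTools

/-! ## The loop sum `Ω_{x,μ}` as a function of the updated link (App. C eq. (C.3)): `L ≥ 2` -/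

section Staples

variable {d L n : ℕ}

/-- On `(ℤ/L)^d` with `L ≥ 2` a site differs from its shift. [folklore] -/
private theorem shift_ne_self (hL : 2 ≤ L) (x : Site d L) (i : Fin d) : x.shift i ≠ x := by
  intro h
  have h1 : (x.shift i) i = x i := by rw [h]
  simp only [Site.shift, Pi.add_apply, Pi.single_eq_same, add_eq_left] at h1
  have : Fact (1 < L) := ⟨hL⟩
  exact one_ne_zero h1

/-- On `(ℤ/L)^d` with `L ≥ 2` a site differs from its backward shift. [folklore] -/
private theorem sub_single_ne_self (hL : 2 ≤ L) (x : Site d L) (i : Fin d) : x - Pi.single i 1 ≠ x := by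
  intro h
  have h1 := congrFun h i
  simp only [Pi.sub_apply, Pi.single_eq_same, sub_eq_self] at h1
  have : Fact (1 < L) := ⟨hL⟩
  exact one_ne_zero h1

/-- **The loop sum is linear in the updated link** (App. C (C.3): `Ω_{x,μ} = U(x,μ)·M`): for `L ≥ 2`, when the
link `(x,μ)` of a configuration whose links `(x−ν̂,ν)` are unitary is replaced by `V`, the ambient loop sum
`Ω_{x,μ}` equals `V` times the sum over `ν ≠ μ` of the upper and lower staples, none of which contains the
link `(x,μ)`. [cite: Luscher2010Trivializing, App. C eq. (C.3), App. D.2] -/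
theorem loopSumAmb_update_eq (hL : 2 ≤ L) {W : AmbConfig d L n} {x : Site d L} {μ : Fin d}
    (hW : ∀ ν, ν ≠ μ → W (x - Pi.single ν 1, ν) ∈ Matrix.unitaryGroup (Fin n) ℂ)
    (V : Matrix (Fin n) (Fin n) ℂ) :
    loopSumAmb (Function.update W (x, μ) V) x μ =
      ∑ ν : Fin d, if ν = μ then (0 : Matrix (Fin n) (Fin n) ℂ) else
        (V * (W (x.shift μ, ν) * (W (x.shift ν, μ))ᴴ * (W (x, ν))ᴴ) +
          V * ((W ((x - Pi.single ν 1).shift μ, ν))ᴴ * (W (x - Pi.single ν 1, μ))ᴴ * W (x - Pi.single ν 1, ν))) := by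
  unfold loopSumAmb
  refine Finset.sum_congr rfl fun ν _ => ?_
  split_ifs with h
  · rfl
  · have hU : (W (x - Pi.single ν 1, ν))ᴴ * W (x - Pi.single ν 1, ν) = 1 := by
      rw [← Matrix.star_eq_conjTranspose]; exact Matrix.mem_unitaryGroup_iff'.1 (hW ν h)
    have ne1 : (x.shift μ, ν) ≠ (x, μ) := fun h' => h (Prod.ext_iff.1 h').2
    have ne2 : (x.shift ν, μ) ≠ (x, μ) := fun h' => shift_ne_self hL x ν (Prod.ext_iff.1 h').1
    have ne3 : (x, ν) ≠ (x, μ) := fun h' => h (Prod.ext_iff.1 h').2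
    have ne4 : ((x - Pi.single ν 1).shift μ, ν) ≠ (x, μ) := fun h' => h (Prod.ext_iff.1 h').2
    have ne5 : (x - Pi.single ν 1, μ) ≠ (x, μ) := fun h' => sub_single_ne_self hL x ν (Prod.ext_iff.1 h').1
    have ne6 : (x - Pi.single ν 1, ν) ≠ (x, μ) := fun h' => h (Prod.ext_iff.1 h').2
    rw [shift_sub_single]
    simp only [Function.update_self, Function.update_of_ne ne1, Function.update_of_ne ne2,
      Function.update_of_ne ne3, Function.update_of_ne ne4, Function.update_of_ne ne5, Function.update_of_ne ne6]
    have key : (W (x - Pi.single ν 1, ν))ᴴ *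
          (W (x - Pi.single ν 1, ν) * V * (W ((x - Pi.single ν 1).shift μ, ν))ᴴ * (W (x - Pi.single ν 1, μ))ᴴ) *
        W (x - Pi.single ν 1, ν) =
        V * ((W ((x - Pi.single ν 1).shift μ, ν))ᴴ * (W (x - Pi.single ν 1, μ))ᴴ * W (x - Pi.single ν 1, ν)) := by
      calc _ = (W (x - Pi.single ν 1, ν))ᴴ * W (x - Pi.single ν 1, ν) * V *
            ((W ((x - Pi.single ν 1).shift μ, ν))ᴴ * (W (x - Pi.single ν 1, μ))ᴴ * W (x - Pi.single ν 1, ν)) := by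
            simp only [Matrix.mul_assoc]
        _ = _ := by rw [hU, Matrix.one_mul]
    rw [key]
    simp only [Matrix.mul_assoc]

/-- The number of directions `ν ≠ μ` is `d − 1`. [folklore] -/
private theorem sum_ite_eq_dir (μ : Fin d) (a : ℝ) :
    ∑ ν : Fin d, (if ν = μ then (0 : ℝ) else a) = (d - 1) * a := by
  rw [Finset.sum_ite, Finset.sum_const_zero, zero_add, Finset.sum_const, nsmul_eq_mul]
  congr 1
  have hfilter : (Finset.univ.filter fun ν : Fin d => ¬ν = μ) = Finset.univ.erase μ := by
    ext ν; simp [Finset.mem_erase]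
  rw [hfilter, Finset.card_erase_of_mem (Finset.mem_univ μ), Finset.card_univ, Fintype.card_fin,
    Nat.cast_sub (Fin.pos μ), Nat.cast_one]

/-- **Frobenius Lipschitz bound of the loop sum in the updated link**: for `L ≥ 2` and a configuration that is
unitary off the link `(x,μ)`, `‖Ω_{x,μ}(V₁) − Ω_{x,μ}(V₂)‖_F ≤ 2(d−1)·‖V₁ − V₂‖_F` — each of the `2(d−1)`
staples is a product of three unitaries. [cite: Luscher2010Trivializing, App. C eq. (C.3), App. D.2 eq. (D.7)] -/
theorem frobNorm_loopSumAmb_update_sub_le (hL : 2 ≤ L) {W : AmbConfig d L n} {x : Site d L} {μ : Fin d}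
    (hW : ∀ e : Edge d L, e ≠ (x, μ) → W e ∈ Matrix.unitaryGroup (Fin n) ℂ) (V₁ V₂ : Matrix (Fin n) (Fin n) ℂ) :
    frobNorm (loopSumAmb (Function.update W (x, μ) V₁) x μ - loopSumAmb (Function.update W (x, μ) V₂) x μ) ≤
      2 * (d - 1) * frobNorm (V₁ - V₂) := by
  have hW' : ∀ ν, ν ≠ μ → W (x - Pi.single ν 1, ν) ∈ Matrix.unitaryGroup (Fin n) ℂ :=
    fun ν hν => hW _ fun h' => hν (Prod.ext_iff.1 h').2
  have hstar : ∀ e : Edge d L, e ≠ (x, μ) → (W e)ᴴ ∈ Matrix.unitaryGroup (Fin n) ℂ := fun e he => by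
    rw [← Matrix.star_eq_conjTranspose]; exact Unitary.star_mem (hW e he)
  rw [loopSumAmb_update_eq hL hW' V₁, loopSumAmb_update_eq hL hW' V₂, ← Finset.sum_sub_distrib]
  calc frobNorm (∑ ν : Fin d, _) ≤ ∑ ν : Fin d, frobNorm _ := frobNorm_sum_le _ _
    _ ≤ ∑ ν : Fin d, (if ν = μ then (0 : ℝ) else 2 * frobNorm (V₁ - V₂)) := Finset.sum_le_sum fun ν _ => ?_
    _ = 2 * (d - 1) * frobNorm (V₁ - V₂) := by rw [sum_ite_eq_dir]; ring
  split_ifs with h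
  · rw [sub_zero, frobNorm_zero]
  · have ne1 : (x.shift μ, ν) ≠ (x, μ) := fun h' => h (Prod.ext_iff.1 h').2
    have ne2 : (x.shift ν, μ) ≠ (x, μ) := fun h' => shift_ne_self hL x ν (Prod.ext_iff.1 h').1
    have ne3 : (x, ν) ≠ (x, μ) := fun h' => h (Prod.ext_iff.1 h').2
    have ne4 : ((x - Pi.single ν 1).shift μ, ν) ≠ (x, μ) := fun h' => h (Prod.ext_iff.1 h').2
    have ne5 : (x - Pi.single ν 1, μ) ≠ (x, μ) := fun h' => sub_single_ne_self hL x ν (Prod.ext_iff.1 h').1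
    have ne6 : (x - Pi.single ν 1, ν) ≠ (x, μ) := fun h' => h (Prod.ext_iff.1 h').2
    have hup : W (x.shift μ, ν) * (W (x.shift ν, μ))ᴴ * (W (x, ν))ᴴ ∈ Matrix.unitaryGroup (Fin n) ℂ :=
      mul_mem (mul_mem (hW _ ne1) (hstar _ ne2)) (hstar _ ne3)
    have hdown : (W ((x - Pi.single ν 1).shift μ, ν))ᴴ * (W (x - Pi.single ν 1, μ))ᴴ * W (x - Pi.single ν 1, ν) ∈
        Matrix.unitaryGroup (Fin n) ℂ :=
      mul_mem (mul_mem (hstar _ ne4) (hstar _ ne5)) (hW _ ne6)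
    rw [show ∀ A B : Matrix (Fin n) (Fin n) ℂ, V₁ * A + V₁ * B - (V₂ * A + V₂ * B) = (V₁ - V₂) * A + (V₁ - V₂) * B
      from fun A B => by noncomm_ring]
    calc _ ≤ frobNorm ((V₁ - V₂) * _) + frobNorm ((V₁ - V₂) * _) := frobNorm_add_le _ _
      _ = 2 * frobNorm (V₁ - V₂) := by rw [frobNorm_mul_unitary _ hup, frobNorm_mul_unitary _ hdown]; ring

end Staples

/-! ## The contraction (D.6)–(D.9) and the bijection -/

section Contraction

variable {d L n : ℕ}

open scoped Matrix.Norms.Frobenius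

/-- `ε Z(W)(e) ∈ 𝔰𝔲(n)` for the Wilson generator `Z = −𝒫Ω`. [cite: Luscher2010Trivializing, §5.1 eq. (5.3), App. A eq. (A.2)] -/
theorem smul_wilsonGenerator_mem_suAlgebra (ε : ℝ) (W : AmbConfig d L n) (e : Edge d L) :
    (ε : ℂ) • wilsonGenerator 0 W e ∈ suAlgebra n := by
  rw [mem_suAlgebra_iff]
  refine ⟨?_, ?_⟩
  · simp only [wilsonGenerator, Matrix.conjTranspose_smul, Matrix.conjTranspose_neg, conjTranspose_suProj, neg_neg,
      Complex.star_def, Complex.conj_ofReal, smul_neg]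
  · simp only [wilsonGenerator, Matrix.trace_smul, Matrix.trace_neg, trace_suProj, neg_zero, smul_zero]

/-- Lüscher's map `f` of (D.6) with the step size absorbed, `F(X) = ε·Z(U_X)(x,μ)` where `U_X` is `W'` with the
link `(x,μ)` replaced by `e^{−X} W'(x,μ)`, unfolded: `F(X) = −ε·𝒫(Ω_{x,μ}(U_X))`. [folklore] -/
private theorem luscherF_eq (ε : ℝ) (W' : AmbConfig d L n) (x : Site d L) (μ : Fin d) (X : Matrix (Fin n) (Fin n) ℂ) :
    (ε : ℂ) • wilsonGenerator 0 (Function.update W' (x, μ) (NormedSpace.exp (-X) * W' (x, μ))) (x, μ) =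
      -((ε : ℂ) • suProj (loopSumAmb (Function.update W' (x, μ) (NormedSpace.exp (-X) * W' (x, μ))) x μ)) := by
  simp only [wilsonGenerator, smul_neg]

/-- **(D.7) in the Frobenius norm**: `‖F(X) − F(Y)‖_F ≤ 2(d−1)|ε|·‖X − Y‖_F` for skew-Hermitian `X, Y`, `L ≥ 2`
and unitary `W'`. [cite: Luscher2010Trivializing, App. D.2 eq. (D.7)] -/
theorem frobNorm_luscherF_sub_le (hL : 2 ≤ L) {ε : ℝ} {W' : AmbConfig d L n} {x : Site d L} {μ : Fin d}
    (hW : ∀ e, W' e ∈ Matrix.unitaryGroup (Fin n) ℂ) {X Y : Matrix (Fin n) (Fin n) ℂ} (hX : Xᴴ = -X) (hY : Yᴴ = -Y) :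
    frobNorm ((ε : ℂ) • wilsonGenerator 0 (Function.update W' (x, μ) (NormedSpace.exp (-X) * W' (x, μ))) (x, μ) -
        (ε : ℂ) • wilsonGenerator 0 (Function.update W' (x, μ) (NormedSpace.exp (-Y) * W' (x, μ))) (x, μ)) ≤
      2 * (d - 1) * |ε| * frobNorm (X - Y) := by
  rw [luscherF_eq, luscherF_eq, neg_sub_neg, ← smul_sub, ← suProj_sub, frobNorm_smul, Complex.norm_real,
    Real.norm_eq_abs]
  have hd1 : (1 : ℝ) ≤ d := by exact_mod_cast Fin.pos μ
  have hd : (0 : ℝ) ≤ 2 * (d - 1) := by linarith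
  calc |ε| * frobNorm (suProj _) ≤ |ε| * frobNorm (loopSumAmb (Function.update W' (x, μ) (NormedSpace.exp (-Y) * W' (x, μ))) x μ -
          loopSumAmb (Function.update W' (x, μ) (NormedSpace.exp (-X) * W' (x, μ))) x μ) := by
        gcongr; exact frobNorm_suProj_le _
    _ ≤ |ε| * (2 * (d - 1) * frobNorm (NormedSpace.exp (-Y) * W' (x, μ) - NormedSpace.exp (-X) * W' (x, μ))) := by
        gcongr; exact frobNorm_loopSumAmb_update_sub_le hL (fun e _ => hW e) _ _
    _ = |ε| * (2 * (d - 1) * frobNorm (NormedSpace.exp (-Y) - NormedSpace.exp (-X))) := by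
        rw [← sub_mul, frobNorm_mul_unitary _ (hW _)]
    _ ≤ |ε| * (2 * (d - 1) * frobNorm (-Y - -X)) := by
        gcongr
        exact frobNorm_exp_sub_exp_le (by rw [Matrix.conjTranspose_neg, hY, neg_neg])
          (by rw [Matrix.conjTranspose_neg, hX, neg_neg])
    _ = 2 * (d - 1) * |ε| * frobNorm (X - Y) := by rw [neg_sub_neg]; ring

/-- **Banach fixed point of (D.6)** on the complete space `(𝔰𝔲(n), ‖·‖_F)` for `2(d−1)|ε| < 1`: existence and
uniqueness of `X⋆ ∈ 𝔰𝔲(n)` with `F(X⋆) = X⋆`. [cite: Luscher2010Trivializing, App. D.2 eqs. (D.6)–(D.8)] -/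
theorem exists_unique_fixedPoint_luscherF (hL : 2 ≤ L) {ε : ℝ} (hε : 2 * (d - 1) * |ε| < 1)
    {W' : AmbConfig d L n} (hW : ∀ e, W' e ∈ Matrix.unitaryGroup (Fin n) ℂ) (x : Site d L) (μ : Fin d) :
    ∃ Xs ∈ suAlgebra n, (ε : ℂ) • wilsonGenerator 0 (Function.update W' (x, μ) (NormedSpace.exp (-Xs) * W' (x, μ))) (x, μ) = Xs ∧
      ∀ X ∈ suAlgebra n, (ε : ℂ) • wilsonGenerator 0 (Function.update W' (x, μ) (NormedSpace.exp (-X) * W' (x, μ))) (x, μ) = X → X = Xs := by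
  classical
  haveI : CompleteSpace ↥(suAlgebra n) :=
    (Submodule.complete_of_finiteDimensional (suAlgebra n)).completeSpace_coe
  let g : ↥(suAlgebra n) → ↥(suAlgebra n) := fun X =>
    ⟨(ε : ℂ) • wilsonGenerator 0 (Function.update W' (x, μ) (NormedSpace.exp (-(X : Matrix (Fin n) (Fin n) ℂ)) * W' (x, μ))) (x, μ),
      smul_wilsonGenerator_mem_suAlgebra ε _ _⟩
  have hd1 : (1 : ℝ) ≤ d := by exact_mod_cast Fin.pos μ
  have hKnn : (0 : ℝ) ≤ 2 * (d - 1) * |ε| := mul_nonneg (by linarith) (abs_nonneg ε)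
  let K : NNReal := ⟨2 * (d - 1) * |ε|, hKnn⟩
  have hdist : ∀ X Y : ↥(suAlgebra n),
      dist X Y = frobNorm ((X : Matrix (Fin n) (Fin n) ℂ) - (Y : Matrix (Fin n) (Fin n) ℂ)) := fun X Y => by
    rw [Subtype.dist_eq, dist_eq_norm, frobNorm_eq_norm]
  have hlip : LipschitzWith K g := by
    refine LipschitzWith.of_dist_le_mul fun X Y => ?_
    have hX := ((mem_suAlgebra_iff _).1 X.2).1
    have hY := ((mem_suAlgebra_iff _).1 Y.2).1
    rw [hdist, hdist]
    exact frobNorm_luscherF_sub_le hL hW hX hY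
  have hK1 : K < 1 := by
    rw [← NNReal.coe_lt_coe]
    show 2 * ((d : ℝ) - 1) * |ε| < ((1 : NNReal) : ℝ)
    rw [NNReal.coe_one]
    exact hε
  have hc : ContractingWith K g := ⟨hK1, hlip⟩
  refine ⟨(ContractingWith.fixedPoint g hc : ↥(suAlgebra n)), (ContractingWith.fixedPoint g hc).2, ?_, ?_⟩
  · exact congrArg Subtype.val (ContractingWith.fixedPoint_isFixedPt (f := g) hc)
  · intro X hXmem hfix
    have h := ContractingWith.fixedPoint_unique hc (x := ⟨X, hXmem⟩) (Subtype.ext hfix)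
    exact congrArg Subtype.val h

/-- **The Euler step preserves `SU(n)`**: `e^{εZ(U)(e)} ∈ SU(n)` since `εZ(U)(e) ∈ 𝔰𝔲(n)`.
[cite: Luscher2010Trivializing, §5.1 eq. (5.1)] -/
theorem eulerStep_coeConfig_mem (ε : ℝ) (e : Edge d L) (U : GaugeConfig d L (Matrix.specialUnitaryGroup (Fin n) ℂ))
    (e' : Edge d L) :
    eulerStep ε e (coeConfig U) e' ∈ Matrix.specialUnitaryGroup (Fin n) ℂ := by
  unfold eulerStep
  rcases eq_or_ne e' e with rfl | hne
  · rw [Function.update_self, coeConfig_apply]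
    have hmem := (mem_suAlgebra_iff _).1 (smul_wilsonGenerator_mem_suAlgebra ε (coeConfig U) e')
    exact mul_mem (exp_mem_specialUnitaryGroup hmem.1 hmem.2) (U e').2
  · rw [Function.update_of_ne hne, coeConfig_apply]
    exact (U e').2

/-- `coeConfig` commutes with updating one link. [folklore] -/
private theorem coeConfig_update (U : GaugeConfig d L (Matrix.specialUnitaryGroup (Fin n) ℂ)) (e : Edge d L)
    (V : Matrix.specialUnitaryGroup (Fin n) ℂ) :
    coeConfig (Function.update U e V) = Function.update (coeConfig U) e (V : Matrix (Fin n) (Fin n) ℂ) := by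
  funext e'
  rcases eq_or_ne e' e with rfl | hne
  · rw [coeConfig_apply, Function.update_self, Function.update_self]
  · rw [coeConfig_apply, Function.update_of_ne hne, Function.update_of_ne hne, coeConfig_apply]

/-- **Uniqueness of the pre-image** (D.2, last sentence): if the Euler step maps the `SU(n)`-valued `U` to
`W'`, then `U` is `W'` with the link `(x,μ)` replaced by `e^{−X⋆}W'(x,μ)`, `X⋆` the unique fixed point of
(D.6). [cite: Luscher2010Trivializing, App. D.2 eq. (D.9)] -/
theorem coeConfig_eq_of_eulerStep_eq {ε : ℝ} {W' : AmbConfig d L n} {x : Site d L} {μ : Fin d}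
    {Xs : Matrix (Fin n) (Fin n) ℂ}
    (huniq : ∀ X ∈ suAlgebra n, (ε : ℂ) • wilsonGenerator 0 (Function.update W' (x, μ) (NormedSpace.exp (-X) * W' (x, μ))) (x, μ) = X → X = Xs)
    {U : GaugeConfig d L (Matrix.specialUnitaryGroup (Fin n) ℂ)}
    (hstep : eulerStep ε (x, μ) (coeConfig U) = W') :
    coeConfig U = Function.update W' (x, μ) (NormedSpace.exp (-Xs) * W' (x, μ)) := by
  set W₁ := coeConfig U with hW₁
  set X₁ : Matrix (Fin n) (Fin n) ℂ := (ε : ℂ) • wilsonGenerator 0 W₁ (x, μ) with hX₁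
  -- the updated link: e^{X₁} W₁(x,μ) = W'(x,μ), so W₁(x,μ) = e^{-X₁} W'(x,μ)
  have hlink : NormedSpace.exp X₁ * W₁ (x, μ) = W' (x, μ) := by
    have h := congrFun hstep (x, μ)
    rwa [eulerStep, Function.update_self] at h
  have hlink' : W₁ (x, μ) = NormedSpace.exp (-X₁) * W' (x, μ) := by
    rw [← hlink, ← Matrix.mul_assoc, exp_neg_mul_exp, Matrix.one_mul]
  -- the other links are untouched
  have hW₁ : W₁ = Function.update W' (x, μ) (NormedSpace.exp (-X₁) * W' (x, μ)) := by
    funext e'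
    rcases eq_or_ne e' (x, μ) with rfl | hne
    · rw [Function.update_self, hlink']
    · rw [Function.update_of_ne hne, ← hstep, eulerStep, Function.update_of_ne hne]
  -- hence X₁ is a fixed point of F, so X₁ = X⋆
  have hfix : (ε : ℂ) • wilsonGenerator 0 (Function.update W' (x, μ) (NormedSpace.exp (-X₁) * W' (x, μ))) (x, μ) = X₁ := by
    rw [← hW₁]
  have hX₁s : X₁ = Xs := huniq X₁ (smul_wilsonGenerator_mem_suAlgebra ε W₁ (x, μ)) hfix
  rw [hW₁, hX₁s]

/-- **The one-link Euler step is a bijection of `SU(n)^E`** for every `d`, `n`, every `L ≥ 2` and every step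
size with `2(d−1)|ε| < 1` (App. D run in the Frobenius norm: `𝒫` is norm-non-increasing, `exp` is 1-Lipschitz
on `𝔰𝔲(n)`, and `Ω_{x,μ}` is the updated link times `2(d−1)` products of three unitaries, so (D.6) is a
`2(d−1)|ε|`-contraction of the complete space `𝔰𝔲(n)`; its fixed point gives the unique pre-image (D.9)). At
`d = 4` this is `|ε| < 1/6`, containing the printed range `|ε| < 1/8` of (5.5) (whose constant `k = 8|ε|` carries
the extra operator-norm factor `4/3` of (D.1)). [cite: Luscher2010Trivializing, §5.2 eqs. (5.5)–(5.6), App. D eqs. (D.5)–(D.9)] -/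
theorem eulerStep_bijective (hL : 2 ≤ L) {ε : ℝ} (hε : 2 * (d - 1) * |ε| < 1) (e : Edge d L) :
    ∃ Ψ : GaugeConfig d L (Matrix.specialUnitaryGroup (Fin n) ℂ) ≃ GaugeConfig d L (Matrix.specialUnitaryGroup (Fin n) ℂ),
      ∀ U, coeConfig (Ψ U) = eulerStep ε e (coeConfig U) := by
  obtain ⟨x, μ⟩ := e
  -- the Euler step as a self-map `Φ` of `SU(n)^E`
  let Φ : GaugeConfig d L (Matrix.specialUnitaryGroup (Fin n) ℂ) → GaugeConfig d L (Matrix.specialUnitaryGroup (Fin n) ℂ) :=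
    fun U e' => ⟨eulerStep ε (x, μ) (coeConfig U) e', eulerStep_coeConfig_mem ε (x, μ) U e'⟩
  have hΦ : ∀ U, coeConfig (Φ U) = eulerStep ε (x, μ) (coeConfig U) := fun U => rfl
  have hunit : ∀ (U' : GaugeConfig d L (Matrix.specialUnitaryGroup (Fin n) ℂ)) (e : Edge d L),
      coeConfig U' e ∈ Matrix.unitaryGroup (Fin n) ℂ :=
    fun U' e => (Matrix.mem_specialUnitaryGroup_iff.1 (U' e).2).1
  have hinj : Function.Injective Φ := by
    intro U₁ U₂ h12
    obtain ⟨Xs, -, -, huniq⟩ := exists_unique_fixedPoint_luscherF hL hε (hunit (Φ U₁)) x μ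
    have h1 : eulerStep ε (x, μ) (coeConfig U₁) = coeConfig (Φ U₁) := (hΦ U₁).symm
    have h2 : eulerStep ε (x, μ) (coeConfig U₂) = coeConfig (Φ U₁) := by rw [h12]; exact (hΦ U₂).symm
    exact coeConfig_injective ((coeConfig_eq_of_eulerStep_eq huniq h1).trans (coeConfig_eq_of_eulerStep_eq huniq h2).symm)
  have hsurj : Function.Surjective Φ := by
    intro U'
    set W' := coeConfig U' with hW'
    obtain ⟨Xs, hXs, hfix, -⟩ := exists_unique_fixedPoint_luscherF hL hε (hunit U') x μ
    have hXs' := (mem_suAlgebra_iff _).1 hXs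
    have hV : NormedSpace.exp (-Xs) * W' (x, μ) ∈ Matrix.specialUnitaryGroup (Fin n) ℂ :=
      mul_mem (exp_mem_specialUnitaryGroup (by rw [Matrix.conjTranspose_neg, hXs'.1, neg_neg])
        (by rw [Matrix.trace_neg, hXs'.2, neg_zero])) (by rw [hW', coeConfig_apply]; exact (U' (x, μ)).2)
    refine ⟨Function.update U' (x, μ) ⟨_, hV⟩, coeConfig_injective ?_⟩
    rw [hΦ, coeConfig_update, ← hW', eulerStep, Function.update_idem, Function.update_self, hfix,
      ← Matrix.mul_assoc, exp_mul_exp_neg, Matrix.one_mul, Function.update_eq_self]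
  exact ⟨Equiv.ofBijective Φ ⟨hinj, hsurj⟩, fun U => rfl⟩

/-- **`EulerStepInvertible` holds** (the cited statement of file B: `d = 4`, `SU(3)`, `|ε| < 1/8`, `L ≥ 2`), as
a case of `eulerStep_bijective` (`2·3·|ε| < 1`). [cite: Luscher2010Trivializing, §5.2 eq. (5.5), App. D] -/
theorem eulerStepInvertible_holds : EulerStepInvertible L := by
  intro _ hL ε hε e
  exact eulerStep_bijective hL (by norm_num at hε ⊢; linarith [hε]) e

end Contraction

end

end Literature.MathematicalPhysics.QuantumFieldTheory.Luscher2010
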